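import Literature.MathematicalPhysics.QuantumFieldTheory.Balaban1983to89.B9Eq369CurvOpSupLetter
import Literature.MathematicalPhysics.QuantumFieldTheory.Balaban1983to89.B9Eq326LocalPartKatoForm

/-!
# `Balaban1983to89.B9Eq326LocalPartZerothOrderWeightedRow` — T. Bałaban, *Propagators for lattice gauge theories in a background field*, Commun. Math. Phys.
# **99** (1985) 389–434 [Balaban1985BackgroundPropagators] (3.26) p. 395 (the local part `A₀ = Δ(U) + D_UD*_U + aQ*Q` of `Δ_a`), (3.69) p. 404 («the
# supremum … is taken over bonds belonging to one of the plaquettes containing the bond b»), (3.10)–(3.11) p. 392, with [Balaban1985Variational] (134)–(136)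
# p. 298 (`A₀ = L_K + K + aQ*Q`, `K = Δ′ − η⁻²𝒦` zeroth order and LOCAL): **THE WEIGHTED VALUE ROW OF THE ZEROTH-ORDER PART — if `‖u(x, μ)‖ ≤ N·W(x)` for a
# site weight `W` with one-step ratios `W(x ± e_ν) ≤ E·W(x)` (`1 ≤ E`; for storey J's product-`cosh` weight `E = e^{a}`,
# `B9Eq342GradientRowNaturalPerturbation.weight_site_shift_le` ∕ `…unshift_le`), then `‖((Δ′ + Q†(a•Q) − κ•𝒦)u)(x, μ)‖ ≤ (p_K·E² ·N + N_Q + ‖κ‖·(d − 1)·δ_𝒦·E²·N)·W(x)`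
# — the `hp` letter (through `B9Eq326LocalPartSliceEquation.norm_slice_data_le`) of `B9Eq342GradientRowAssembly` §5 for EVERY μ-slice of `A₀u = f`, from the
# tree's LOCAL sup letters `B9Eq369CurvOpSupLetter.norm_apply_curvOp_le_local` (Δ′) and a local reading of `B11Eq135WeitzenbockCarrier.norm_weitzOp_apply_le`
# (𝒦); the block-local penalty's row `N_Q` stays DISPLAYED (abstract `Q` at this layer)** — the OWNER's plan v11 §2 (ii) (`t4/b2b-balaban-t4-ne9-p1/g91/
# PLAN-V11-STOREY-G1.md`), successor memo `t4/b2b-balaban-t4-ne9-formalise-leaf-05/g84/V28-NEXT.md` item 3 (c)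

statement-level skeleton of published theorems with citation tags; proofs where landed; nothing here is a claim about the Yang–Mills mass gap

CITATION HEADER (lean-in-tree rule).  Audit cell `pub-balaban`, sub-cell `t4`, BINDER row NE9; filed by NE9 crux-team LEAF PROVER 05
(`b2b-balaban-t4-ne9-formalise-leaf-05`, gen 85).  Imports the OWNER lineage's `B9Eq369CurvOpSupLetter` (g93: `norm_apply_curvOp_le_local`) and
`B9Eq326LocalPartKatoForm` (g92: `weitzOpK`, `equiv_weitzOpK`, `localPart_eq_kato_add`; through it `B11Eq135WeitzenbockCarrier`: `weitzOp_apply`,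
`weitzOp_summand_self`, `norm_sum_le_of_forall_ne`).  SOURCE READ first-hand in the held text layer [Balaban1985BackgroundPropagators]
(`paper:balaban1985-cmp99-background-propagators`): p. 395 (3.26); p. 404 (3.69) (the pointwise size of `Δ′` by a LOCAL supremum); p. 392 (3.10)–(3.11);
[Balaban1985Variational] p. 298 (134)–(136), p. 299 (140) «the fact that DPD* is a bounded operator».  The weighted reading is the cell's storey J device
(t4-ne9-idea-1 N17 ∕ N22 ∕ N44–N46; this lineage g77–g85): a finite-range operator maps a weighted value row to a weighted value row at the price of the
weight's ratio across its range — [folklore]; nothing printed is a hypothesis; the `[cite: …]` tags are TEXT LOCATIONS.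

WHAT IS PROVED (sorry-free; 0 `def`; [folklore]).
* §1 **`weighted_row_of_local_letter`** — generic: a LOCAL sup letter `(∀ b′ near b, ‖v(b′)‖ ≤ M) ⟹ ‖(Pv)(b)‖ ≤ k·M`, a row `‖v(b)‖ ≤ N·W(b)` and the
  ratio `W(b′) ≤ E·W(b)` for `b′ near b` give `‖(Pv)(b)‖ ≤ k·E·N·W(b)` (any types, any relation `near`).
* §2 **`norm_weitzOp_apply_le_local`** — the curvature operator `𝒦` of (135) with the holonomy letter `δ_𝒦` (as in `norm_weitzOp_apply_le`) and a LOCAL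
  bound `‖A(x + e_μ − e_ν, ν)‖ ≤ M` (`ν ≠ μ`): `‖(𝒦A)(x, μ)‖ ≤ (d − 1)·δ_𝒦·M`; **`norm_weitzOp_apply_le_weighted`** — with `‖A(b)‖ ≤ N·W(b.1)` and the
  one-step ratios: `‖(𝒦A)(x, μ)‖ ≤ (d − 1)·δ_𝒦·(E²·N)·W(x)` (the corner `x + e_μ − e_ν` is two steps from `x`).
* §3 **`norm_apply_curvOp_le_weighted`** — the Riesz operator `Δ′ = curvOp φ τ η U` on `BondL2K` with the model letters of `B9Eq369CurvOpSupLetter`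
  (`hφ`, `hstar`, `hτ`, `hU`, `hRe`, `hIm`; `p_K = 768·|DirPair d|·M_τ·M_φ²·(‖η^d‖∕c₀)·‖η⁻¹‖²·δ`), `1 ≤ E`, `0 ≤ W`: `‖(Δ′g)(b)‖ ≤ p_K·(E²·N·W(b.1))` (every
  bond of a plaquette through `b` starts within two steps of `b.1`).
* §4 **`norm_zerothOrder_apply_le_weighted`** — the sum: for `P = Δ′ + Q†(a•Q) − κ•𝒦_{R,S}` (the second summand of
  `B9Eq326LocalPartKatoForm.localPart_eq_kato_add` at `R, S = Ad U, Ad U⁻¹`, `κ = η⁻²`; here ANY transporter data with `SR = RS = 1` and ANY `κ : ℂ`) and a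
  DISPLAYED weighted row `‖(Q†(a•Q)u)(b)‖ ≤ N_Q·W(b.1)` of the block-local penalty:
  `‖(Pu)(x, μ)‖ ≤ (p_K·E²·N + N_Q + ‖κ‖·((d − 1)·δ_𝒦·E²·N))·W(x)`.
HONEST SCOPE.  Bookkeeping of ranges; the SIZES `p_K` (= O(α₀) on (3.35), NOT asserted), `δ_𝒦` (≤ 2·max_p‖U(∂p) − 1‖, NOT asserted), `N_Q` (supplier for
the torus block averaging: `B9Eq383QSemiLocal`, NOT composed here — `Q` is abstract in the OWNER's `A₀`) and the value row `N` of `u = A₀⁻¹f` (storey D for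
`A₀`: the OWNER's (I0)∕(D0) in the block currency — the currency junction is NOT here) stay letters; nothing of [B9] Thm 3.1∕3.3∕3.11 is asserted, valued or
discharged.  NOT NE9 (cell pub-balaban: NE9 NOT PRINTED ∕ NOT PROVED; «NE9 ⇐ the named binders»; row WALLED ON A MODEL (O-NE9-1; #5 UNRULED); spine
PROVED 0∕9; rung (B)+1 on a finite T⁴ — NOT infinite volume, NOT mass gap, NOT Clay; HONEST DEPENDENCY: continuum YM on T⁴ ⇐ BetaPertH ∧ nine spine estimates
(0/9 proved); BetaPertH ⇐ (D1) ∧ (D4) ∧ CAP+tail; G-an2-4 gates asym, D1 and NE2/3/4).  NEW file; nothing modified.  Net new unproved facts: 0.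
-/

noncomputable section

set_option autoImplicit false

open scoped InnerProductSpace BigOperators

namespace Literature.MathematicalPhysics.QuantumFieldTheory.Balaban1983to89.B9Eq326LocalPartZerothOrderWeightedRow

open B4Sect5Torus (TSite)
open B9SectCLatticeCarrier (Bond DirPair bpos btgt shift unshift shift_unshift unshift_shift)
open B9Eq311L2Pairing (WL2)
open B11Eq103H1Complex (BondL2K)
open B9Eq310DeltaPrime (reHol imHol)
open B9Eq310HessianOperator (curvOp)
open B11Eq135WeitzenbockCarrier (weitzOp weitzOp_apply weitzOp_summand_self norm_sum_le_of_forall_ne)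
open B9Eq326LocalPartKatoForm (weitzOpK equiv_weitzOpK)
open B9Eq369CurvOpSupLetter (norm_apply_curvOp_le_local)

/-! ## §1 A local sup letter carries a weighted value row to a weighted value row -/

section Generic

variable {B V V' : Type*} [SeminormedAddCommGroup V] [SeminormedAddCommGroup V']

/-- **LOCAL LETTER ⟹ WEIGHTED ROW.**  If `‖(Pv)(b)‖ ≤ k·M` whenever `0 ≤ M` and `‖v(b′)‖ ≤ M` for all `b′` NEAR `b` (a local sup letter), `‖v(b′)‖ ≤ N·W(b′)`
everywhere (`0 ≤ N`, `0 ≤ W`) and the weight ratio across the range is `W(b′) ≤ E·W(b)` (`b′` near `b`, `0 ≤ E`), then `‖(Pv)(b)‖ ≤ k·E·N·W(b)`. [folklore]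
[cite: Balaban1985BackgroundPropagators, (3.69) p.404] -/
theorem weighted_row_of_local_letter (Pv : B → V') (v : B → V) (Wb : B → ℝ) (near : B → B → Prop) {k E N : ℝ} (hE : 0 ≤ E) (hN : 0 ≤ N)
    (hW : ∀ b, 0 ≤ Wb b) (hP : ∀ (b : B) (M : ℝ), 0 ≤ M → (∀ b', near b b' → ‖v b'‖ ≤ M) → ‖Pv b‖ ≤ k * M)
    (hv : ∀ b, ‖v b‖ ≤ N * Wb b) (hnear : ∀ b b', near b b' → Wb b' ≤ E * Wb b) (b : B) :
    ‖Pv b‖ ≤ k * E * N * Wb b := by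
  have hM : 0 ≤ E * N * Wb b := mul_nonneg (mul_nonneg hE hN) (hW b)
  have h := hP b (E * N * Wb b) hM fun b' hb' =>
    (hv b').trans ((mul_le_mul_of_nonneg_left (hnear b b' hb') hN).trans (le_of_eq (by ring)))
  exact h.trans (le_of_eq (by ring))

end Generic

/-! ## §2 The curvature operator `𝒦` of (135): local letter and weighted row -/

section Weitz

variable {d : ℕ} {Pd : Fin d → ℕ} {𝕜' : Type*} [NormedField 𝕜'] {V : Type*} [NormedAddCommGroup V] [NormedSpace 𝕜' V]

/-- **`𝒦` IS BOUNDED POINTWISE BY A LOCAL SUPREMUM**: with mutually inverse transporters, the holonomy letter `‖(S(w,ν)R(w,μ) − R(x,μ)S(z,ν))v‖ ≤ δ_𝒦‖v‖`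
(`μ ≠ ν`, `0 ≤ δ_𝒦`) and `‖A(x + e_μ − e_ν, ν)‖ ≤ M` for `ν ≠ μ`: `‖(𝒦A)(x, μ)‖ ≤ (d − 1)·δ_𝒦·M` — the local reading of
`B11Eq135WeitzenbockCarrier.norm_weitzOp_apply_le` (same proof, the global bound `‖A‖ ≤ a` replaced by the bound on the `d − 1` corners that `(𝒦A)(x, μ)` sees).
[folklore] [cite: Balaban1985Variational, (135)–(136) p.298; Balaban1985BackgroundPropagators, (3.69) p.404] -/
theorem norm_weitzOp_apply_le_local (R S : Bond d Pd → V →ₗ[𝕜'] V) (hSR : ∀ b w, S b (R b w) = w) (hRS : ∀ b w, R b (S b w) = w) {δ : ℝ}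
    (hδ : 0 ≤ δ)
    (hHol : ∀ (x : TSite d Pd) (μ ν : Fin d), μ ≠ ν → ∀ v : V,
      ‖S (unshift ν x, ν) (R (unshift ν x, μ) v) - R (x, μ) (S (shift μ (unshift ν x), ν) v)‖ ≤ δ * ‖v‖)
    (A : Bond d Pd → V) (x : TSite d Pd) (μ : Fin d) {M : ℝ} (hM : ∀ ν, ν ≠ μ → ‖A (shift μ (unshift ν x), ν)‖ ≤ M) :
    ‖weitzOp R S A (x, μ)‖ ≤ (d - 1 : ℝ) * δ * M := by
  rw [weitzOp_apply]
  have hmain := norm_sum_le_of_forall_ne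
    (fun ν => S (unshift ν x, ν) (R (unshift ν x, μ) (A (shift μ (unshift ν x), ν))) -
      R (x, μ) (S (shift μ (unshift ν x), ν) (A (shift μ (unshift ν x), ν)))) μ (δ * M)
    (weitzOp_summand_self R S hSR hRS A x μ) (fun ν hne =>
      (hHol x μ ν hne.symm (A (shift μ (unshift ν x), ν))).trans (mul_le_mul_of_nonneg_left (hM ν hne) hδ))
  exact hmain.trans (le_of_eq (by ring))

/-- **THE WEIGHTED VALUE ROW OF `𝒦A`**: `‖A(b)‖ ≤ N·W(b.1)` (`0 ≤ N`) for a site weight with one-step ratios `W(x + e_ν) ≤ E·W(x)`, `W(x − e_ν) ≤ E·W(x)`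
(`0 ≤ E`) ⟹ `‖(𝒦A)(x, μ)‖ ≤ (d − 1)·δ_𝒦·(E²·N)·W(x)` — the corner `x + e_μ − e_ν` is reached in two steps. [folklore]
[cite: Balaban1985Variational, (135)–(136) p.298; Balaban1985BackgroundPropagators, (3.69) p.404] -/
theorem norm_weitzOp_apply_le_weighted (R S : Bond d Pd → V →ₗ[𝕜'] V) (hSR : ∀ b w, S b (R b w) = w) (hRS : ∀ b w, R b (S b w) = w) {δ : ℝ}
    (hδ : 0 ≤ δ)
    (hHol : ∀ (x : TSite d Pd) (μ ν : Fin d), μ ≠ ν → ∀ v : V,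
      ‖S (unshift ν x, ν) (R (unshift ν x, μ) v) - R (x, μ) (S (shift μ (unshift ν x), ν) v)‖ ≤ δ * ‖v‖)
    (A : Bond d Pd → V) (Wt : TSite d Pd → ℝ) {E N : ℝ} (hE : 0 ≤ E) (hN : 0 ≤ N) (hWs : ∀ (x : TSite d Pd) (ν : Fin d), Wt (shift ν x) ≤ E * Wt x)
    (hWu : ∀ (x : TSite d Pd) (ν : Fin d), Wt (unshift ν x) ≤ E * Wt x) (hv : ∀ b : Bond d Pd, ‖A b‖ ≤ N * Wt b.1) (x : TSite d Pd) (μ : Fin d) :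
    ‖weitzOp R S A (x, μ)‖ ≤ (d - 1 : ℝ) * δ * (E ^ 2 * N) * Wt x := by
  have hM : ∀ ν, ν ≠ μ → ‖A (shift μ (unshift ν x), ν)‖ ≤ E ^ 2 * N * Wt x := fun ν _ => by
    have h2 : Wt (shift μ (unshift ν x)) ≤ E ^ 2 * Wt x :=
      (hWs (unshift ν x) μ).trans ((mul_le_mul_of_nonneg_left (hWu x ν) hE).trans (le_of_eq (by ring)))
    calc ‖A (shift μ (unshift ν x), ν)‖ ≤ N * Wt (shift μ (unshift ν x)) := hv _
      _ ≤ N * (E ^ 2 * Wt x) := mul_le_mul_of_nonneg_left h2 hN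
      _ = E ^ 2 * N * Wt x := by ring
  exact (norm_weitzOp_apply_le_local R S hSR hRS hδ hHol A x μ hM).trans (le_of_eq (by ring))

end Weitz

/-! ## §3 The Riesz operator `Δ′` on `BondL2K`: weighted row from the plaquette-local letter -/

section Curv

variable {d : ℕ} {Pd : Fin d → ℕ} {𝔸 : Type*} [NormedRing 𝔸] [StarRing 𝔸] [NormedAlgebra ℂ 𝔸] [StarModule ℂ 𝔸]
  {W : Type*} [NormedAddCommGroup W] [InnerProductSpace ℂ W] [FiniteDimensional ℂ W] (φ : W ≃ₗ[ℂ] 𝔸) {Mφ : ℝ}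
  (hφ : ∀ w, ‖φ w‖ ≤ Mφ * ‖w‖) (hMφ : 0 ≤ Mφ) (hstar : ∀ X : 𝔸, ‖star X‖ ≤ ‖X‖)
  {c₀ : ℝ} [Fact (0 < c₀)] (τ : 𝔸 →ₗ[ℂ] ℂ) {Mτ : ℝ} (hτ : ∀ X Y : 𝔸, ‖τ (X * Y)‖ ≤ Mτ * ‖X‖ * ‖Y‖) (hMτ : 0 ≤ Mτ)
  (η : ℝ) (U : Bond d Pd → 𝔸ˣ) (hU : ∀ b, ‖(U b : 𝔸)‖ ≤ 1 ∧ ‖(((U b)⁻¹ : 𝔸ˣ) : 𝔸)‖ ≤ 1) {δ : ℝ} (hδ : 0 ≤ δ)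
  (hRe : ∀ p : B9SectCLatticeCarrier.Plaq d Pd, ‖reHol U p - 1‖ ≤ δ) (hIm : ∀ p : B9SectCLatticeCarrier.Plaq d Pd, ‖imHol U p‖ ≤ δ)

include hφ hMφ hstar hτ hMτ hU hδ hRe hIm in
/-- **THE WEIGHTED VALUE ROW OF `Δ′g`**: `‖g(b)‖ ≤ N·W(b.1)` (`0 ≤ N`, `0 ≤ W`), one-step ratios `≤ E` with `1 ≤ E` ⟹
`‖(Δ′g)(b)‖ ≤ p_K·(E²·N·W(b.1))`, `p_K = 768·|DirPair d|·M_τ·M_φ²·(‖η^d‖∕c₀)·‖η⁻¹‖²·δ` — `B9Eq369CurvOpSupLetter.norm_apply_curvOp_le_local` with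
`M := E²·N·W(b.1)`: every bond of a plaquette through `b` starts at `b.1`, `b.1 ± e_ν` or `b.1 − e_ν + e_ν′`. [folklore]
[cite: Balaban1985BackgroundPropagators, (3.69) p.404, (3.10) p.392, (3.11) p.392] -/
theorem norm_apply_curvOp_le_weighted (g : BondL2K ℂ d Pd c₀ W) (Wt : TSite d Pd → ℝ) {E N : ℝ} (hE : 1 ≤ E) (hN : 0 ≤ N) (hW : ∀ x, 0 ≤ Wt x)
    (hWs : ∀ (x : TSite d Pd) (ν : Fin d), Wt (shift ν x) ≤ E * Wt x) (hWu : ∀ (x : TSite d Pd) (ν : Fin d), Wt (unshift ν x) ≤ E * Wt x)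
    (hv : ∀ b : Bond d Pd, ‖WL2.equiv ℂ (fun _ : Bond d Pd => c₀) W g b‖ ≤ N * Wt b.1) (b : Bond d Pd) :
    ‖WL2.equiv ℂ (fun _ : Bond d Pd => c₀) W (curvOp φ τ η U g) b‖ ≤
      768 * Fintype.card (DirPair d) * Mτ * Mφ ^ 2 * (‖((η : ℂ)) ^ d‖ / c₀) * ‖((η : ℂ))⁻¹‖ ^ 2 * δ * (E ^ 2 * N * Wt b.1) := by
  have hE0 : 0 ≤ E := zero_le_one.trans hE
  have hEE : E ≤ E ^ 2 := by nlinarith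
  refine norm_apply_curvOp_le_local φ hφ hMφ hstar τ hτ hMτ η U hU hδ hRe hIm g b (mul_nonneg (mul_nonneg (pow_nonneg hE0 2) hN) (hW _))
    fun x q hb => ?_
  -- the base site `x` of the plaquette is `b.1` or one step back from it
  have hx : Wt x ≤ E * Wt b.1 := by
    rcases hb with h | h | h | h
    · rw [h]; exact (le_mul_of_one_le_left (hW x) hE)
    · rw [h]; exact (le_mul_of_one_le_left (hW x) hE)
    · have e : x = unshift q.1.1 b.1 := by rw [h, unshift_shift]
      rw [e]; exact hWu _ _
    · have e : x = unshift q.1.2 b.1 := by rw [h, unshift_shift]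
      rw [e]; exact hWu _ _
  have hx2 : Wt x ≤ E ^ 2 * Wt b.1 := hx.trans (mul_le_mul_of_nonneg_right hEE (hW _))
  have hs : ∀ ν, Wt (shift ν x) ≤ E ^ 2 * Wt b.1 := fun ν =>
    (hWs x ν).trans ((mul_le_mul_of_nonneg_left hx hE0).trans (le_of_eq (by ring)))
  have hb1 : ∀ ν, ‖WL2.equiv ℂ (fun _ : Bond d Pd => c₀) W g (x, ν)‖ ≤ E ^ 2 * N * Wt b.1 := fun ν =>
    (hv (x, ν)).trans ((mul_le_mul_of_nonneg_left hx2 hN).trans (le_of_eq (by ring)))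
  have hb2 : ∀ ν ν', ‖WL2.equiv ℂ (fun _ : Bond d Pd => c₀) W g (shift ν x, ν')‖ ≤ E ^ 2 * N * Wt b.1 := fun ν ν' =>
    (hv (shift ν x, ν')).trans ((mul_le_mul_of_nonneg_left (hs ν) hN).trans (le_of_eq (by ring)))
  linarith [hb1 q.1.1, hb1 q.1.2, hb2 q.1.1 q.1.2, hb2 q.1.2 q.1.1]

/-! ## §4 The zeroth-order part `P = Δ′ + Q†(a•Q) − κ•𝒦` of `A₀` -/

include hφ hMφ hstar hτ hMτ hU hδ hRe hIm in
/-- **THE WEIGHTED VALUE ROW OF THE ZEROTH-ORDER PART OF `A₀`** (the `hp` supplier of `B9Eq342GradientRowAssembly` §5 for every μ-slice of `A₀u = f`, via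
`B9Eq326LocalPartSliceEquation.norm_slice_data_le`): `P = Δ′ + Q†(a•Q) − κ•𝒦_{R,S}` (`B9Eq326LocalPartKatoForm.localPart_eq_kato_add`: `A₀ = (L_K + Q†(a•Q)) +
(Δ′ − η⁻²𝒦)` — here ANY `κ`, ANY `R, S` with `SR = RS = 1` and the holonomy letter `δ_𝒦`), `‖u(b)‖ ≤ N·W(b.1)`, one-step ratios `≤ E` (`1 ≤ E`), `0 ≤ W`, and
the block-local penalty's row DISPLAYED (`‖(Q†(a•Q)u)(b)‖ ≤ N_Q·W(b.1)`):
`‖(Pu)(x, μ)‖ ≤ (p_K·E²·N + N_Q + ‖κ‖·((d − 1)·δ_𝒦·E²·N))·W(x)`. [folklore]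
[cite: Balaban1985BackgroundPropagators, (3.26) p.395, (3.69) p.404; Balaban1985Variational, (134)–(136) p.298, (140) p.299] -/
theorem norm_zerothOrder_apply_le_weighted {F : Type*} [NormedAddCommGroup F] [InnerProductSpace ℂ F] [FiniteDimensional ℂ F]
    (Q : BondL2K ℂ d Pd c₀ W →ₗ[ℂ] F) (a : ℝ) (κ : ℂ) (R S : Bond d Pd → W →ₗ[ℂ] W) (hSR : ∀ b w, S b (R b w) = w)
    (hRS : ∀ b w, R b (S b w) = w) {δK : ℝ} (hδK : 0 ≤ δK)
    (hHol : ∀ (x : TSite d Pd) (μ ν : Fin d), μ ≠ ν → ∀ v : W,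
      ‖S (unshift ν x, ν) (R (unshift ν x, μ) v) - R (x, μ) (S (shift μ (unshift ν x), ν) v)‖ ≤ δK * ‖v‖)
    (u : BondL2K ℂ d Pd c₀ W) (Wt : TSite d Pd → ℝ) {E N NQ : ℝ} (hE : 1 ≤ E) (hN : 0 ≤ N) (hW : ∀ x, 0 ≤ Wt x)
    (hWs : ∀ (x : TSite d Pd) (ν : Fin d), Wt (shift ν x) ≤ E * Wt x) (hWu : ∀ (x : TSite d Pd) (ν : Fin d), Wt (unshift ν x) ≤ E * Wt x)
    (hv : ∀ b : Bond d Pd, ‖WL2.equiv ℂ (fun _ : Bond d Pd => c₀) W u b‖ ≤ N * Wt b.1)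
    (hQ : ∀ b : Bond d Pd, ‖WL2.equiv ℂ (fun _ : Bond d Pd => c₀) W ((LinearMap.adjoint Q ∘ₗ ((a : ℂ) • Q)) u) b‖ ≤ NQ * Wt b.1)
    (x : TSite d Pd) (μ : Fin d) :
    ‖WL2.equiv ℂ (fun _ : Bond d Pd => c₀) W
        ((curvOp φ τ η U + LinearMap.adjoint Q ∘ₗ ((a : ℂ) • Q) - κ • weitzOpK ℂ c₀ R S :
          BondL2K ℂ d Pd c₀ W →ₗ[ℂ] BondL2K ℂ d Pd c₀ W) u) (x, μ)‖ ≤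
      (768 * Fintype.card (DirPair d) * Mτ * Mφ ^ 2 * (‖((η : ℂ)) ^ d‖ / c₀) * ‖((η : ℂ))⁻¹‖ ^ 2 * δ * (E ^ 2 * N) + NQ +
        ‖κ‖ * ((d - 1 : ℝ) * δK * (E ^ 2 * N))) * Wt x := by
  have hE0 : 0 ≤ E := zero_le_one.trans hE
  have h1 := norm_apply_curvOp_le_weighted φ hφ hMφ hstar τ hτ hMτ η U hU hδ hRe hIm u Wt hE hN hW hWs hWu hv (x, μ)
  have h2 := hQ (x, μ)
  have h3 : ‖WL2.equiv ℂ (fun _ : Bond d Pd => c₀) W (κ • weitzOpK ℂ c₀ R S u) (x, μ)‖ ≤ ‖κ‖ * ((d - 1 : ℝ) * δK * (E ^ 2 * N) * Wt x) := by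
    rw [WL2.equiv_smul, Pi.smul_apply, norm_smul, equiv_weitzOpK]
    exact mul_le_mul_of_nonneg_left
      (norm_weitzOp_apply_le_weighted R S hSR hRS hδK hHol _ Wt hE0 hN hWs hWu hv x μ) (norm_nonneg κ)
  rw [LinearMap.sub_apply, LinearMap.add_apply, WL2.equiv_sub, WL2.equiv_add, Pi.sub_apply, Pi.add_apply]
  calc ‖WL2.equiv ℂ (fun _ : Bond d Pd => c₀) W (curvOp φ τ η U u) (x, μ) +
          WL2.equiv ℂ (fun _ : Bond d Pd => c₀) W ((LinearMap.adjoint Q ∘ₗ ((a : ℂ) • Q)) u) (x, μ) -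
          WL2.equiv ℂ (fun _ : Bond d Pd => c₀) W (κ • weitzOpK ℂ c₀ R S u) (x, μ)‖
        ≤ ‖WL2.equiv ℂ (fun _ : Bond d Pd => c₀) W (curvOp φ τ η U u) (x, μ)‖ +
          ‖WL2.equiv ℂ (fun _ : Bond d Pd => c₀) W ((LinearMap.adjoint Q ∘ₗ ((a : ℂ) • Q)) u) (x, μ)‖ +
          ‖WL2.equiv ℂ (fun _ : Bond d Pd => c₀) W (κ • weitzOpK ℂ c₀ R S u) (x, μ)‖ := norm_sub_le_of_le (norm_add_le _ _) le_rfl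
    _ ≤ _ := by
        have e := add_le_add (add_le_add h1 h2) h3
        exact e.trans (le_of_eq (by ring))

end Curv

end Literature.MathematicalPhysics.QuantumFieldTheory.Balaban1983to89.B9Eq326LocalPartZerothOrderWeightedRow

end
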